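import Literature.AnabelianGeometry.SemiGraphs.PSCSeparatingCoveringsIrreducibleMultiNodalVerticial
import Literature.AnabelianGeometry.SemiGraphs.PSCSeparatingCoveringsTwoComponentAffineEdges
import Literature.AnabelianGeometry.SemiGraphs.PSCUnrVerticialSeparatingCoveringsIrreducibleMultiNodal
import Mathlib.GroupTheory.SpecificGroups.Dihedral
import HarnessLib

/-!
# [CombGC] Prop. 1.2, proof p. 9: EDGE-LIKE separating coverings at IRREDUCIBLE MULTI-NODAL data (row F-2827)

Mochizuki, *A combinatorial version of the Grothendieck conjecture*, Tohoku Math. J. **59** (2007)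
[CombGC], PROOF of Proposition 1.2, author's manuscript p. 9, the resp'd (edge) case ("there exists a
finite étale … `Π_G`-covering `G' → G` whose restriction to the anabelioid `G_{e₂}` is trivial, but whose
restriction to the anabelioid `G_{e₁}` is nontrivial") [cite: MochizukiCombGC2007, Prop 1.2 proof p.9];
typed LEVEL-WISE as `PSCDatum.EdgeLikeSeparatingCoverings` (abc-iut-w4-d081, row P12-L01-E; abc-iut
FACT-LIST row F-2827, the edge conjunct of F-2829 / F-2830).

PROOF-ONLY file (abc-iut-f-164 gen 5) at the data of IRREDUCIBLE `k`-NODAL SHAPE with `r ≥ 2` marked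
points and `g ≥ 1` (one vertex with `k` loops; node groups `cl ι⟨b_m⟩`, `m < k`, cusp groups `cl ι⟨c_j⟩`,
over a pro-`Σ` completion `ι : Γ_{g,r} → Π` of the smoothing).  Every edge generator is a member of a free
basis of `Γ_{g,r}` (`b_m` of the `c₀`-eliminating basis; `c_j` of a basis eliminating another cusp,
`exists_freeGroupBasis_eq_c`, `r ≥ 2`), so abc-iut-f-166's ENGINE
`edgeLikeSeparatingCoverings_of_rankOneFreeFactors` applies once, for every ordered pair of distinct edges
`(e₁, e₂)`, a homomorphism `Γ_{g,r} → M` killing the generator of `e₂` but not that of `e₁` is exhibited.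
The separating homomorphisms are LETTER ASSIGNMENTS on the `c₀`-eliminating basis with values in the
dihedral group `D₃` (`x = r 2` a rotation, `u = sr 0`, `v = sr 1` reflections with `[v,u] = x⁻¹`): the value
on the eliminated cusp is read off the relation, `χ(c_0) = χ(∏_i [a_i,b_i])⁻¹ · χ(c_1⋯c_{r−1})⁻¹`
(`map_lift_c_zero`), and a nonabelian target is what lets `c_0` be killed while `c_j` survives (and
conversely) when only the handle `(a_0, b_0)` is available to balance the relation — the one-relator
bookkeeping that an abelian character cannot do at `r = 2`.

* `edgeLikeSeparatingCoverings_of_irreducibleMultiNodal` — **F-2827 at every such datum**;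
* `separatingCoverings_of_irreducibleMultiNodal`, `prop12_of_irreducibleMultiNodal` — with F-2826 (this
  seat's `…Verticial.lean`) and F-2828 (gen 4's `unrVerticialSeparatingCoverings_of_irreducibleMultiNodal`):
  **F-2829 (all three conjuncts) and [CombGC] Prop. 1.2 (i)(ii) IN FULL (F-0459, F-0438 both clauses)**
  at every irreducible `k`-nodal datum with `r ≥ 2`, `g ≥ 1` — the first complete Prop. 1.2 at a datum
  whose vertex group is not a free factor (w5-d183's `prop12_of_separating`).

Instance forms at data of the shape of genuine irreducible nodal curves; consistency evidence for the
typed rows, not the printed theorems for all pointed stable curves.  0 definitions; nothing here takes a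
side on [IUTchIII] Cor. 3.12.
-/

noncomputable section

namespace Literature.AnabelianGeometry.SemiGraphs

open scoped Pointwise
open Literature.GroupTheory.CombinatorialGroupTheory
open Literature.GroupTheory.CombinatorialGroupTheory.PuncturedSurfaceGroup
open Literature.GroupTheory.CombinatorialGroupTheory.FreeFactorFibredTwist (lift_apply_basis)
open SemiGraphOfAnabelioids (IsProSigmaCompletion)

namespace PSCDatum

/-! ### List bookkeeping: products with at most one nontrivial factor -/

section Lists

variable {M : Type*} [Monoid M]

/-- A padded `finRange` product all of whose factors but one are trivial. [cite: LyndonSchupp2001, I.3 Prop 3.8] -/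
theorem prod_map_finRange_ite_eq_of_single (n : ℕ) (p : Fin n → Prop) [DecidablePred p] (F : Fin n → M)
    (i₀ : Fin n) (hF : ∀ i, i ≠ i₀ → p i → F i = 1) :
    ((List.finRange n).map fun i => if p i then F i else 1).prod = if p i₀ then F i₀ else 1 := by
  classical
  have e : (fun i : Fin n => if p i then F i else 1) =
      fun i => if i = i₀ then (if p i₀ then F i₀ else 1) else 1 := by
    funext i
    by_cases hi : i = i₀
    · subst hi
      rw [if_pos rfl]
    · by_cases hp : p i
      · rw [if_pos hp, if_neg hi, hF i hi hp]
      · rw [if_neg hp, if_neg hi]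
  rw [e, prod_map_finRange_ite_eq_single]

/-- Pushing a homomorphism through a padded `finRange` product. [cite: LyndonSchupp2001, I.3 Prop 3.8] -/
theorem map_prod_map_finRange_ite {N : Type*} [Monoid N] (χ : M →* N) (n : ℕ) (p : Fin n → Prop)
    [DecidablePred p] (F : Fin n → M) :
    χ ((List.finRange n).map fun i => if p i then F i else 1).prod =
      ((List.finRange n).map fun i => if p i then χ (F i) else 1).prod := by
  rw [map_list_prod, List.map_map]
  congr 1
  refine List.map_congr_left fun i _ => ?_
  simp only [Function.comp_apply]
  split_ifs
  · rfl
  · exact map_one χ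

end Lists

/-! ### The eliminated cusp `c₀` under a letter assignment -/

section Relation

variable {g r' : ℕ} {M : Type*} [Group M]
  {b₀ : FreeGroupBasis ((Fin g × Bool) ⊕ Fin r') (PuncturedSurfaceGroup g (r' + 1))}
  (ha : ∀ i, b₀ (Sum.inl (i, false)) = a i) (hb : ∀ i, b₀ (Sum.inl (i, true)) = b i)
  (hc : ∀ j : Fin r', b₀ (Sum.inr j) = c (Fin.succ j))

/-- **`c_0 = (∏_i [a_i,b_i])⁻¹ (c_1⋯c_{r'})⁻¹` in `Γ_{g,r'+1}`.** [cite: MochizukiSemiAnbd2006, Ex. 2.10 p.31] -/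
theorem c_zero_eq_inv_mul_inv :
    c (g := g) (⟨0, Nat.succ_pos r'⟩ : Fin (r' + 1)) =
      (((List.finRange g).map fun i : Fin g => if (i : ℕ) < g then
          a (r := r' + 1) i * b i * (a i)⁻¹ * (b i)⁻¹ else 1).prod)⁻¹ *
        (((List.finRange (r' + 1)).map fun j : Fin (r' + 1) =>
          if 0 + 1 ≤ (j : ℕ) then c (g := g) j else 1).prod)⁻¹ := by
  classical
  have h := comm_split_mul_cusp_split_eq_one (g := g) (r := r' + 1) g 0
  rw [comm_prod_ge_self_eq_one, mul_one, cusp_prod_lt_zero_eq_one, one_mul,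
    prod_map_finRange_ite_le_peel (r' + 1) 0 (Nat.succ_pos r') (fun j => c (g := g) j)] at h
  exact eq_mul_inv_of_mul_eq (eq_inv_of_mul_eq_one_right h)

include ha hb hc in
/-- **The eliminated cusp under a letter assignment with at most one nontrivial handle and one nontrivial
cusp letter**: for `χ = b₀.lift f` with `f(a_i) = 1` (`i ≠ i₀`) and `f(c_{j+1}) = 1` (`j ≠ j₀`),
`χ(c_0) = [f(a_{i₀}), f(b_{i₀})]⁻¹ · f(c_{j₀+1})⁻¹`. [cite: MochizukiSemiAnbd2006, Ex. 2.10 p.31] -/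
theorem map_lift_c_zero (f : (Fin g × Bool) ⊕ Fin r' → M) (i₀ : Fin g) (j₀ : Fin r')
    (hfa : ∀ i, i ≠ i₀ → f (Sum.inl (i, false)) = 1) (hfc : ∀ j, j ≠ j₀ → f (Sum.inr j) = 1) :
    b₀.lift f (c (g := g) (⟨0, Nat.succ_pos r'⟩ : Fin (r' + 1))) =
      (f (Sum.inl (i₀, false)) * f (Sum.inl (i₀, true)) * (f (Sum.inl (i₀, false)))⁻¹ *
          (f (Sum.inl (i₀, true)))⁻¹)⁻¹ * (f (Sum.inr j₀))⁻¹ := by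
  classical
  set χ := b₀.lift f with hχ
  have hχa : ∀ i, χ (a i) = f (Sum.inl (i, false)) := fun i => by rw [← ha, hχ, lift_apply_basis]
  have hχb : ∀ i, χ (b i) = f (Sum.inl (i, true)) := fun i => by rw [← hb, hχ, lift_apply_basis]
  have hχc : ∀ j : Fin r', χ (c (Fin.succ j)) = f (Sum.inr j) := fun j => by rw [← hc, hχ, lift_apply_basis]
  rw [c_zero_eq_inv_mul_inv, map_mul, map_inv, map_inv, map_prod_map_finRange_ite, map_prod_map_finRange_ite]
  congr 2
  · rw [prod_map_finRange_ite_eq_of_single g _ _ i₀, if_pos i₀.2, map_mul, map_mul, map_mul, map_inv,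
      map_inv, hχa, hχb]
    intro i hi _
    rw [map_mul, map_mul, map_mul, map_inv, map_inv, hχa, hfa i hi]
    group
  · rw [prod_map_finRange_ite_eq_of_single (r' + 1) _ _ (Fin.succ j₀), if_pos (by simp), hχc]
    intro j hj hj1
    have hj0 : j ≠ 0 := by
      rintro rfl
      exact absurd hj1 (by simp)
    rw [← Fin.succ_pred j hj0, hχc, hfc]
    intro h
    exact hj (by rw [← Fin.succ_pred j hj0, h])

end Relation

/-! ### F-2827 at irreducible multi-nodal data -/

section Datum

variable {P : Type} [Group P] [TopologicalSpace P] [IsTopologicalGroup P]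
variable [CompactSpace P] [TotallyDisconnectedSpace P] {Sigma : Set ℕ} {g r : ℕ}

/-- **F-2827 / row P12-L01-E (`EdgeLikeSeparatingCoverings`, `V' := V`) at EVERY datum of irreducible
`k`-nodal shape with `r ≥ 2`, `g ≥ 1`.**  f-166's rank-one engine; separating homomorphisms to `D₃` by
letter assignment on the `c₀`-eliminating basis (node `b_{m₁}` ↦ `x`; cusp `c_{j₁}` ↦ `x`; for the
eliminated cusp `c_0` the handle `(a_0, b_0) ↦ (v, u)` with `[v,u] = x⁻¹` balances the relation).
[cite: MochizukiCombGC2007, Prop 1.2 proof p.9] -/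
theorem edgeLikeSeparatingCoverings_of_irreducibleMultiNodal (hne : Sigma.Nonempty)
    (hprime : ∀ p ∈ Sigma, p.Prime) (ι : PuncturedSurfaceGroup g r →* P)
    (hι : IsProSigmaCompletion Sigma ι) (G : PSCDatum P) {k : ℕ} (hk : k ≤ g) (hg : 1 ≤ g) (hr : 2 ≤ r)
    (e : G.graph.C ≃ Fin r)
    (hC : ∀ c', G.cuspGp c' = ((cuspInertia (g := g) (e c')).map ι).topologicalClosure)
    (eN : G.graph.N ≃ Fin k)
    (hE : ∀ m, G.nodeGp m = ((Subgroup.zpowers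
      (PuncturedSurfaceGroup.b (r := r) (Fin.castLE hk (eN m)))).map ι).topologicalClosure) :
    G.EdgeLikeSeparatingCoverings := by
  classical
  obtain ⟨r', rfl⟩ : ∃ r', r = r' + 1 := ⟨r - 1, by omega⟩
  have hr' : 1 ≤ r' := by omega
  obtain ⟨b₀, ha, hb, hc⟩ := exists_freeGroupBasis_elim_zero g r'
  -- edge generators
  let xs : G.graph.N ⊕ G.graph.C → PuncturedSurfaceGroup g (r' + 1) :=
    Sum.elim (fun n => PuncturedSurfaceGroup.b (Fin.castLE hk (eN n))) (fun c' => c (e c'))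
  have hx : ∀ ed, G.edgeGp ed = ((Subgroup.zpowers (xs ed)).map ι).topologicalClosure := by
    rintro (n | c')
    · exact hE n
    · exact hC c'
  have hfac : ∀ ed, ∃ (κ : Type) (bκ : FreeGroupBasis κ (PuncturedSurfaceGroup g (r' + 1))) (κ₀ : κ),
      bκ κ₀ = xs ed := by
    rintro (n | c')
    · exact ⟨_, b₀, Sum.inl (Fin.castLE hk (eN n), true), hb _⟩
    · exact exists_freeGroupBasis_eq_c (by omega) (e c')
  -- the dihedral values
  let x : DihedralGroup 3 := DihedralGroup.r 2
  let u : DihedralGroup 3 := DihedralGroup.sr 0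
  let v : DihedralGroup 3 := DihedralGroup.sr 1
  have hx1 : x ≠ 1 := by decide
  have hxinv : x⁻¹ ≠ 1 := by decide
  have hvu : (v * u * v⁻¹ * u⁻¹)⁻¹ * (1 : DihedralGroup 3)⁻¹ ≠ 1 := by decide
  have hvux : (v * u * v⁻¹ * u⁻¹)⁻¹ * x⁻¹ = 1 := by decide
  -- evaluation of letter characters
  have hχb : ∀ (f : (Fin g × Bool) ⊕ Fin r' → DihedralGroup 3) (i : Fin g),
      b₀.lift f (PuncturedSurfaceGroup.b i) = f (Sum.inl (i, true)) := fun f i => by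
    rw [← hb, lift_apply_basis]
  have hχc : ∀ (f : (Fin g × Bool) ⊕ Fin r' → DihedralGroup 3) (j : Fin (r' + 1)) (hj : j ≠ 0),
      b₀.lift f (c j) = f (Sum.inr (j.pred hj)) := fun f j hj => by
    conv_lhs => rw [← Fin.succ_pred j hj, ← hc, lift_apply_basis]
  have hc0 : ∀ (f : (Fin g × Bool) ⊕ Fin r' → DihedralGroup 3) (j : Fin (r' + 1)) (hj : j = 0)
      (i₀ : Fin g) (j₀ : Fin r'),
      (∀ i, i ≠ i₀ → f (Sum.inl (i, false)) = 1) → (∀ j, j ≠ j₀ → f (Sum.inr j) = 1) →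
      b₀.lift f (c j) = (f (Sum.inl (i₀, false)) * f (Sum.inl (i₀, true)) * (f (Sum.inl (i₀, false)))⁻¹ *
          (f (Sum.inl (i₀, true)))⁻¹)⁻¹ * (f (Sum.inr j₀))⁻¹ := by
    intro f j hj i₀ j₀ hfa hfc
    have : j = ⟨0, Nat.succ_pos r'⟩ := Fin.ext (by rw [hj]; rfl)
    rw [this]
    exact map_lift_c_zero ha hb hc f i₀ j₀ hfa hfc
  refine G.edgeLikeSeparatingCoverings_of_rankOneFreeFactors hι ⟨hne.some, hne.some_mem, hprime _ hne.some_mem⟩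
    xs hx hfac (M := DihedralGroup 3) ?_
  rintro (n₁ | c₁) (n₂ | c₂) hne12
  · -- node alive, node killed
    set m₁ := eN n₁ with hm₁
    have hm : Fin.castLE hk (eN n₂) ≠ Fin.castLE hk m₁ := fun h => hne12 (by
      rw [Sum.inl.injEq]
      exact eN.injective (Fin.castLE_injective hk h).symm)
    refine ⟨b₀.lift fun y => if y = Sum.inl (Fin.castLE hk m₁, true) then x else 1, ?_, ?_⟩
    · change b₀.lift _ (PuncturedSurfaceGroup.b (Fin.castLE hk (eN n₂))) = 1
      rw [hχb, if_neg (fun h => hm (by simpa using h))]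
    · change b₀.lift _ (PuncturedSurfaceGroup.b (Fin.castLE hk m₁)) ≠ 1
      rw [hχb, if_pos rfl]
      exact hx1
  · -- node alive, cusp killed
    set m₁ := eN n₁ with hm₁
    refine ⟨b₀.lift fun y => if y = Sum.inl (Fin.castLE hk m₁, true) then x else 1, ?_, ?_⟩
    · change b₀.lift _ (c (e c₂)) = 1
      by_cases hj : e c₂ = 0
      · rw [hc0 _ _ hj ⟨0, hg⟩ ⟨0, hr'⟩ (fun i _ => if_neg (by simp)) (fun j _ => if_neg (by simp)),
          if_neg (show ¬ (Sum.inl (⟨0, hg⟩, false) : (Fin g × Bool) ⊕ Fin r') =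
            Sum.inl (Fin.castLE hk m₁, true) by simp),
          if_neg (show ¬ (Sum.inr ⟨0, hr'⟩ : (Fin g × Bool) ⊕ Fin r') =
            Sum.inl (Fin.castLE hk m₁, true) by simp)]
        by_cases h : (Sum.inl (⟨0, hg⟩, true) : (Fin g × Bool) ⊕ Fin r') = Sum.inl (Fin.castLE hk m₁, true)
        · rw [if_pos h]; group
        · rw [if_neg h]; group
      · rw [hχc _ _ hj, if_neg (by simp)]
    · change b₀.lift _ (PuncturedSurfaceGroup.b (Fin.castLE hk m₁)) ≠ 1
      rw [hχb, if_pos rfl]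
      exact hx1
  · -- cusp alive, node killed
    by_cases hj : e c₁ = 0
    · -- alive `c_0`: put `x` on the letter `c_1`; `χ(c_0) = x⁻¹`
      refine ⟨b₀.lift fun y => if y = Sum.inr ⟨0, hr'⟩ then x else 1, ?_, ?_⟩
      · change b₀.lift _ (PuncturedSurfaceGroup.b (Fin.castLE hk (eN n₂))) = 1
        rw [hχb, if_neg (by simp)]
      · change b₀.lift _ (c (e c₁)) ≠ 1
        rw [hc0 _ _ hj ⟨0, hg⟩ ⟨0, hr'⟩ (fun i _ => if_neg (by simp)) (fun j hj' => if_neg (by simpa using hj')),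
          if_neg (by simp), if_neg (by simp), if_pos rfl]
        simpa using hxinv
    · refine ⟨b₀.lift fun y => if y = Sum.inr ((e c₁).pred hj) then x else 1, ?_, ?_⟩
      · change b₀.lift _ (PuncturedSurfaceGroup.b (Fin.castLE hk (eN n₂))) = 1
        rw [hχb, if_neg (by simp)]
      · change b₀.lift _ (c (e c₁)) ≠ 1
        rw [hχc _ _ hj, if_pos rfl]
        exact hx1
  · -- cusp alive, cusp killed
    have hj12 : e c₁ ≠ e c₂ := fun h => hne12 (by rw [e.injective h])
    by_cases hj₁ : e c₁ = 0
    · -- alive `c_0`, killed `c_{j₂}`, `j₂ ≠ 0`: the handle `(a_0,b_0) ↦ (v,u)`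
      have hj₂ : e c₂ ≠ 0 := fun h => hj12 (hj₁.trans h.symm)
      refine ⟨b₀.lift fun y => if y = Sum.inl (⟨0, hg⟩, false) then v
          else if y = Sum.inl (⟨0, hg⟩, true) then u else 1, ?_, ?_⟩
      · change b₀.lift _ (c (e c₂)) = 1
        rw [hχc _ _ hj₂, if_neg (by simp), if_neg (by simp)]
      · change b₀.lift _ (c (e c₁)) ≠ 1
        rw [hc0 _ _ hj₁ ⟨0, hg⟩ ⟨0, hr'⟩ (fun i hi => by rw [if_neg (by simpa using hi), if_neg (by simp)])
            (fun j _ => by rw [if_neg (by simp), if_neg (by simp)]),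
          if_pos rfl, if_neg (by simp), if_pos rfl, if_neg (by simp), if_neg (by simp)]
        exact hvu
    · by_cases hj₂ : e c₂ = 0
      · -- alive `c_{j₁}` (`j₁ ≠ 0`), killed `c_0`: `c_{j₁} ↦ x` and the handle `(a_0,b_0) ↦ (v,u)`
        refine ⟨b₀.lift fun y => if y = Sum.inr ((e c₁).pred hj₁) then x
            else if y = Sum.inl (⟨0, hg⟩, false) then v
            else if y = Sum.inl (⟨0, hg⟩, true) then u else 1, ?_, ?_⟩
        · change b₀.lift _ (c (e c₂)) = 1
          rw [hc0 _ _ hj₂ ⟨0, hg⟩ ((e c₁).pred hj₁)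
              (fun i hi => by rw [if_neg (by simp), if_neg (by simpa using hi), if_neg (by simp)])
              (fun j hj' => by rw [if_neg (by simpa using hj'), if_neg (by simp), if_neg (by simp)]),
            if_neg (by simp), if_pos rfl, if_neg (by simp), if_neg (by simp), if_pos rfl, if_pos rfl]
          exact hvux
        · change b₀.lift _ (c (e c₁)) ≠ 1
          rw [hχc _ _ hj₁, if_pos rfl]
          exact hx1
      · -- both `≠ 0`: the letter of `c_{j₁}`
        refine ⟨b₀.lift fun y => if y = Sum.inr ((e c₁).pred hj₁) then x else 1, ?_, ?_⟩
        · change b₀.lift _ (c (e c₂)) = 1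
          rw [hχc _ _ hj₂, if_neg]
          intro h
          apply hj12
          have h' := (Sum.inr.inj h)
          rw [← Fin.succ_pred (e c₂) hj₂, ← Fin.succ_pred (e c₁) hj₁, h']
        · change b₀.lift _ (c (e c₁)) ≠ 1
          rw [hχc _ _ hj₁, if_pos rfl]
          exact hx1

/-- **F-2829 (`SeparatingCoverings`, all three conjuncts) at EVERY irreducible `k`-nodal datum with
`r ≥ 2`, `g ≥ 1`**: F-2826 (`verticialSeparatingCoverings_of_irreducibleMultiNodal'`, cut-off character
twist), F-2827 (above) and F-2828 (abc-iut-f-164 gen 4, `unrVerticialSeparatingCoverings_of_irreducibleMultiNodal`).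
[cite: MochizukiCombGC2007, Prop 1.2 proof p.9] -/
theorem separatingCoverings_of_irreducibleMultiNodal (hne : Sigma.Nonempty)
    (hprime : ∀ p ∈ Sigma, p.Prime) (ι : PuncturedSurfaceGroup g r →* P)
    (hι : IsProSigmaCompletion Sigma ι) (G : PSCDatum P) {k : ℕ} (hk : k ≤ g) (hg : 1 ≤ g) (hr : 2 ≤ r)
    (e : G.graph.C ≃ Fin r)
    (hC : ∀ c', G.cuspGp c' = ((cuspInertia (g := g) (e c')).map ι).topologicalClosure)
    (v₀ : G.graph.V) (hV : ∀ w, w = v₀) (eN : G.graph.N ≃ Fin k)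
    (hE : ∀ m, G.nodeGp m = ((Subgroup.zpowers
      (PuncturedSurfaceGroup.b (r := r) (Fin.castLE hk (eN m)))).map ι).topologicalClosure)
    (hV₀ : G.vertGp v₀ = ((Subgroup.closure {x : PuncturedSurfaceGroup g r |
        (∃ m : Fin k, x = PuncturedSurfaceGroup.b (Fin.castLE hk m) ∨
          x = PuncturedSurfaceGroup.a (Fin.castLE hk m) * PuncturedSurfaceGroup.b (Fin.castLE hk m) *
            (PuncturedSurfaceGroup.a (Fin.castLE hk m))⁻¹) ∨
        (∃ i : Fin g, k ≤ (i : ℕ) ∧ (x = PuncturedSurfaceGroup.a i ∨ x = PuncturedSurfaceGroup.b i)) ∨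
        ∃ j : Fin r, x = PuncturedSurfaceGroup.c j}).map ι).topologicalClosure)
    (hgen : G.genus v₀ = g - k) :
    G.SeparatingCoverings :=
  ⟨G.verticialSeparatingCoverings_of_irreducibleMultiNodal' hne hprime ι hι hk (by omega) (Or.inr hr) v₀ hV hV₀,
    G.edgeLikeSeparatingCoverings_of_irreducibleMultiNodal hne hprime ι hι hk hg hr e hC eN hE,
    G.unrVerticialSeparatingCoverings_of_irreducibleMultiNodal hne hprime ι hι hk e hC v₀ hV eN hE hV₀ hgen⟩

/-- **[CombGC] Prop. 1.2 (i) and (ii) IN FULL at EVERY irreducible `k`-nodal datum with `r ≥ 2`, `g ≥ 1`**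
(F-0459 all three cases; F-0438 BOTH clauses — the vertex group `Π_v` is an HNN-base, not a free factor
of `π₁`): w5-d183's `prop12_of_separating` applied to F-2829 above. [cite: MochizukiCombGC2007, Prop 1.2 pp.8-9] -/
theorem prop12_of_irreducibleMultiNodal (hne : Sigma.Nonempty)
    (hprime : ∀ p ∈ Sigma, p.Prime) (ι : PuncturedSurfaceGroup g r →* P)
    (hι : IsProSigmaCompletion Sigma ι) (G : PSCDatum P) {k : ℕ} (hk : k ≤ g) (hg : 1 ≤ g) (hr : 2 ≤ r)
    (e : G.graph.C ≃ Fin r)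
    (hC : ∀ c', G.cuspGp c' = ((cuspInertia (g := g) (e c')).map ι).topologicalClosure)
    (v₀ : G.graph.V) (hV : ∀ w, w = v₀) (eN : G.graph.N ≃ Fin k)
    (hE : ∀ m, G.nodeGp m = ((Subgroup.zpowers
      (PuncturedSurfaceGroup.b (r := r) (Fin.castLE hk (eN m)))).map ι).topologicalClosure)
    (hV₀ : G.vertGp v₀ = ((Subgroup.closure {x : PuncturedSurfaceGroup g r |
        (∃ m : Fin k, x = PuncturedSurfaceGroup.b (Fin.castLE hk m) ∨
          x = PuncturedSurfaceGroup.a (Fin.castLE hk m) * PuncturedSurfaceGroup.b (Fin.castLE hk m) *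
            (PuncturedSurfaceGroup.a (Fin.castLE hk m))⁻¹) ∨
        (∃ i : Fin g, k ≤ (i : ℕ) ∧ (x = PuncturedSurfaceGroup.a i ∨ x = PuncturedSurfaceGroup.b i)) ∨
        ∃ j : Fin r, x = PuncturedSurfaceGroup.c j}).map ι).topologicalClosure)
    (hgen : G.genus v₀ = g - k) :
    (G.VerticialOpenInterDeterminesVertex ∧ G.EdgeLikeOpenInterDeterminesEdge ∧
      G.UnrVerticialOpenInterDeterminesVertex) ∧
    (G.VerticialEdgeLikeCommensurablyTerminal ∧ G.UnrVerticialCommensurablyTerminal) :=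
  G.prop12_of_separating (G.separatingCoverings_of_irreducibleMultiNodal hne hprime ι hι hk hg hr e hC v₀ hV eN
    hE hV₀ hgen)

end Datum

end PSCDatum

end Literature.AnabelianGeometry.SemiGraphs

end
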